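import Summits.CriticalPhenomena.PercolationContinuityZ3.Theorems.PercNearOneGluingNoHeavyLowerTailQ7PsiSetObserver
import Literature.Probability.Percolation.LonePortSumGeneral
import HarnessLib

/-!
# `NoHeavyLowerTail` (stmt-CriticalPhenomena-4575) — conditioning a function of one cluster on another cluster,
# with a decreasing off-cluster event (tools for the set-observer certificate)

Support file (`--supports stmt-CriticalPhenomena-4575`), coupling seat `prim-cplus-coupling` (gen 13).  No
definitions, no named facts, no sorries.  Memo A5-COUPLING-gen13.md §3.2 (the "Harris in `G ∖ S̄`" step of B6).

In the set-observer version of the (GΨ₃) certificate (Kozma–Nitzan Question 9 at `|A| = 3`, companion file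
`…Q7PsiSetObserverDom.lean`) the weak-relay part is obtained from the observer part by conditioning on the cluster
of the strong relay `x`: given `C_x = S`, the cluster of `z` and the events "`N ∖ S` does not reach `y`, `z`" live in
the fresh configuration off `S̄` (BHK's display (10), `BHK2006.sum_cond_cluster_sdiff`), where `F(C_z)` is increasing
and the separation events are decreasing, so Harris' inequality bounds their product.  This file packages that step:
* `Q7Psi.offCluster_harris_le` — Harris off the cluster of `s` (sum form), for a nonnegative cluster weight;
* `Q7Psi.setIntegral_offEvent_le` — `∫_{P(C_x) ∩ E} F(C_z) ≤ ∫_{P(C_x) ∩ E} k_F(C_x)`, `k_F(S) = E F(C_z(η ∖ S̄))`, for a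
  decreasing event `E` read off `S̄` and `F ≥ 0` monotone;
* `Q7Psi.setIntegral_cluster_tower` — the equality without `E` (tower property).
[cite: VandenbergHaggstromKahn2005, §1 pp. 6–8 (Harris; display (10)); §2.1 Lemma 2.4 (p. 10)]
-/

namespace Summit.CriticalPhenomena.PercolationContinuityZ3.Theorems

open MeasureTheory Set Literature.Probability.LatticeModels Literature.Probability.Percolation
open scoped Classical
open KNPreFKG BHK2006 DecisionTree LonePortSum LonePortSumGeneral

noncomputable section

namespace Q7Psi

variable {V : Type*} [Fintype V]

/-- **Harris off the cluster.**  For a nonnegative function `Φ` of the open edge cluster of `s`, a nonnegative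
increasing statistic `f` and a decreasing statistic `g ≤ 1`, both read on the configuration with the pairs meeting
the cluster of `s` deleted (`ω ∖ W̄(C_s ω)`):
`Σ_ω w(ω) Φ(C_s) f(ω∖W̄) g(ω∖W̄) ≤ Σ_ω w(ω) Φ(C_s) k_f(C_s) g(ω∖W̄)` with `k_f(C) = Σ_η w(η) f(η ∖ W̄(C))`:
given the cluster of `s` the coordinates off `W̄` are fresh (BHK's display (10), `BHK2006.sum_cond_cluster_sdiff`),
and Harris' inequality for the fresh configuration bounds `E[f g]` by `E[f] E[g]`.
[cite: VandenbergHaggstromKahn2005, §1 pp. 6–8 (Harris; display (10))] -/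
theorem offCluster_harris_le (w : Sym2 V → unitInterval) (s : V) (Φ : Set (Sym2 V) → ℝ)
    (hΦ : ∀ C, 0 ≤ Φ C) (f g : BondConfig V → ℝ) (hf : Monotone f) (hf0 : ∀ ω, 0 ≤ f ω)
    (hg : Antitone g) (hg1 : ∀ ω, g ω ≤ 1) :
    ∑ ω, weight (fun e => (w e : ℝ)) ω * (Φ (openEdgeCluster ω s) *
        (f (ω \ {e | ∃ v ∈ e, v = s ∨ ∃ e' ∈ openEdgeCluster ω s, v ∈ e'}) *
          g (ω \ {e | ∃ v ∈ e, v = s ∨ ∃ e' ∈ openEdgeCluster ω s, v ∈ e'}))) ≤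
      ∑ ω, weight (fun e => (w e : ℝ)) ω * (Φ (openEdgeCluster ω s) *
        ((∑ η, weight (fun e => (w e : ℝ)) η *
            f (η \ {e | ∃ v ∈ e, v = s ∨ ∃ e' ∈ openEdgeCluster ω s, v ∈ e'})) *
          g (ω \ {e | ∃ v ∈ e, v = s ∨ ∃ e' ∈ openEdgeCluster ω s, v ∈ e'}))) := by
  classical
  set w' : Sym2 V → ℝ := fun e => (w e : ℝ) with hw'
  have hw0 : ∀ e, 0 ≤ w' e := fun e => (w e).2.1
  have hw1 : ∀ e, w' e ≤ 1 := fun e => (w e).2.2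
  have hm : ∑ ω, weight w' ω = 1 := by
    have h1 := integral_prodBernoulli_eq_sum w fun _ => (1 : ℝ)
    simp only [integral_const, probReal_univ, smul_eq_mul, mul_one] at h1
    exact h1.symm
  -- `k_f(C)` and `k_g(C)`
  set kf : Set (Sym2 V) → ℝ := fun C => ∑ η, weight w' η * f (η \ {e | ∃ v ∈ e, v = s ∨ ∃ e' ∈ C, v ∈ e'})
    with hkf
  -- display (10) for `K = Φ · f · g` and for `K = Φ · k_f · g`
  have e1 := sum_cond_cluster_sdiff w' hm s (fun C ξ => Φ C * (f ξ * g ξ))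
  have e2 := sum_cond_cluster_sdiff w' hm s (fun C ξ => Φ C * (kf C * g ξ))
  rw [e1, e2]
  refine Finset.sum_le_sum fun ω _ => mul_le_mul_of_nonneg_left ?_ (weight_nonneg hw0 hw1 ω)
  set B : Set (Sym2 V) := {e | ∃ v ∈ e, v = s ∨ ∃ e' ∈ openEdgeCluster ω s, v ∈ e'} with hB
  -- inner Harris for the fresh configuration: `η ↦ f(η ∖ B)` increasing, `η ↦ g(η ∖ B)` decreasing
  have hfB : Monotone fun η : Set (Sym2 V) => f (η \ B) := fun η η' h => hf (Set.sdiff_subset_sdiff_left h)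
  have hgB : Antitone fun η : Set (Sym2 V) => g (η \ B) := fun η η' h => hg (Set.sdiff_subset_sdiff_left h)
  have hH := harris_mono_anti hw0 hw1 hm (f := fun η => f (η \ B)) (g := fun η => g (η \ B))
    (fun η => hf0 _) hfB hgB (M := 1) (fun η => hg1 _)
  -- rewrite both sides
  have lhs : ∑ η, weight w' η * (Φ (openEdgeCluster ω s) * (f (η \ B) * g (η \ B))) =
      Φ (openEdgeCluster ω s) * ∑ η, weight w' η * (f (η \ B) * g (η \ B)) := by
    rw [Finset.mul_sum]
    exact Finset.sum_congr rfl fun η _ => by ring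
  have hkfC : kf (openEdgeCluster ω s) = ∑ η, weight w' η * f (η \ B) := rfl
  have rhs : ∑ η, weight w' η * (Φ (openEdgeCluster ω s) * (kf (openEdgeCluster ω s) * g (η \ B))) =
      Φ (openEdgeCluster ω s) * ((∑ η, weight w' η * f (η \ B)) * ∑ η, weight w' η * g (η \ B)) := by
    rw [hkfC]
    calc ∑ η, weight w' η * (Φ (openEdgeCluster ω s) * ((∑ η', weight w' η' * f (η' \ B)) * g (η \ B)))
        = ∑ η, (Φ (openEdgeCluster ω s) * ∑ η', weight w' η' * f (η' \ B)) * (weight w' η * g (η \ B)) :=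
          Finset.sum_congr rfl fun η _ => by ring
      _ = (Φ (openEdgeCluster ω s) * ∑ η', weight w' η' * f (η' \ B)) * ∑ η, weight w' η * g (η \ B) := by
          rw [← Finset.mul_sum]
      _ = _ := by ring
  rw [lhs, rhs]
  exact mul_le_mul_of_nonneg_left hH (hΦ _)


omit [Fintype V] in
/-- The pairs meeting the open vertex cluster of `x` are the pairs meeting `{x} ∪ V(C_x)` (edge-cluster form). [folklore] -/
theorem barV_openCluster_eq (ω : BondConfig V) (x : V) :
    {e : Sym2 V | ∃ v ∈ e, v ∈ openCluster ω x} =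
      {e | ∃ v ∈ e, v = x ∨ ∃ e' ∈ openEdgeCluster ω x, v ∈ e'} := by
  ext e
  simp only [mem_setOf_eq, openCluster_eq_setOf_openEdgeCluster]

omit [Fintype V] in
/-- Locality of the cluster of a separated vertex: if `x ↮ z` then the open vertex cluster of `z` is read on the
configuration with the pairs meeting the cluster of `x` deleted. [cite: VandenbergHaggstromKahn2005, §1 p. 8] -/
theorem openCluster_sdiff_bar_eq {ω : BondConfig V} {x z : V} (hxz : ¬ (openGraph ω).Reachable x z) :
    openCluster (ω \ {e | ∃ v ∈ e, v = x ∨ ∃ e' ∈ openEdgeCluster ω x, v ∈ e'}) z = openCluster ω z := by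
  ext a
  exact reachable_sdiff_bar_iff hxz a

/-- **Conditioning a function of another cluster on the cluster of `x`, with a decreasing off-cluster event.**
For `F ≥ 0` monotone on vertex sets, a condition `P` on the vertex cluster of `x` under which `x ↮ z`, and a
decreasing event `E` which, under `P`, is read off the pairs meeting the cluster of `x`:
`∫_{P(C_x) ∩ E} F(C_z) ≤ ∫_{P(C_x) ∩ E} k_F(C_x)` with `k_F(S) = ∫ F(C_z(η ∖ {pairs meeting S})) dμ(η)` — given `C_x = S`,
the cluster of `z` lives in the fresh configuration off `S̄`, where `F(C_z)` (increasing) and `𝟙_E` (decreasing) are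
negatively correlated (Harris). [cite: VandenbergHaggstromKahn2005, §1 pp. 6–8] -/
theorem setIntegral_offEvent_le (w : Sym2 V → unitInterval) (x z : V) (F : Set V → ℝ)
    (hF : ∀ S T : Set V, S ⊆ T → F S ≤ F T) (hF0 : ∀ S, 0 ≤ F S) (P : Set V → Prop)
    (hPz : ∀ ω : BondConfig V, P (openCluster ω x) → ¬ (openGraph ω).Reachable x z)
    (E : Set (BondConfig V)) (hE : IsLowerSet E)
    (hloc : ∀ ω : BondConfig V, P (openCluster ω x) →
      (ω \ {e | ∃ v ∈ e, v = x ∨ ∃ e' ∈ openEdgeCluster ω x, v ∈ e'} ∈ E ↔ ω ∈ E)) :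
    ∫ ω in {ω : BondConfig V | P (openCluster ω x)} ∩ E, F (openCluster ω z) ∂(prodBernoulli w) ≤
      ∫ ω in {ω : BondConfig V | P (openCluster ω x)} ∩ E,
        (∫ η, F (openCluster (η \ {e | ∃ v ∈ e, v ∈ openCluster ω x}) z) ∂(prodBernoulli w)) ∂(prodBernoulli w) := by
  classical
  set μ := prodBernoulli w with hμ
  set w' : Sym2 V → ℝ := fun e => (w e : ℝ) with hw'
  set D : Set (BondConfig V) := {ω : BondConfig V | P (openCluster ω x)} ∩ E with hD
  -- cluster-level data for `offCluster_harris_le`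
  set Φ : Set (Sym2 V) → ℝ := fun C => if P {a | a = x ∨ ∃ e ∈ C, a ∈ e} then 1 else 0 with hΦ
  have hΦ0 : ∀ C, 0 ≤ Φ C := fun C => by simp only [hΦ]; split_ifs <;> norm_num
  set f : BondConfig V → ℝ := fun ξ => F (openCluster ξ z) with hf
  have hfm : Monotone f := fun ξ ξ' h => hF _ _ (openCluster_mono h z)
  set g : BondConfig V → ℝ := ind E with hg
  have hga : Antitone g := fun ξ ξ' h => ind_anti_of_isLowerSet hE h
  have hg1 : ∀ ξ, g ξ ≤ 1 := fun ξ => ind_le_one E ξ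
  have hΦC : ∀ ω : BondConfig V, Φ (openEdgeCluster ω x) = if P (openCluster ω x) then 1 else 0 := by
    intro ω; simp only [hΦ, ← openCluster_eq_setOf_openEdgeCluster]
  -- pointwise: on `D` everything is read off `W̄(C_x)`
  have hpt : ∀ ω : BondConfig V, F (openCluster ω z) * ind D ω =
      Φ (openEdgeCluster ω x) *
        (f (ω \ {e | ∃ v ∈ e, v = x ∨ ∃ e' ∈ openEdgeCluster ω x, v ∈ e'}) *
          g (ω \ {e | ∃ v ∈ e, v = x ∨ ∃ e' ∈ openEdgeCluster ω x, v ∈ e'})) := by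
    intro ω
    rw [hΦC ω]
    by_cases hP : P (openCluster ω x)
    · rw [if_pos hP, one_mul, hf, hg]
      simp only
      rw [openCluster_sdiff_bar_eq (hPz ω hP)]
      by_cases hωE : ω ∈ E
      · rw [ind_of_mem (show ω ∈ D from ⟨hP, hωE⟩), ind_of_mem ((hloc ω hP).2 hωE)]
      · rw [ind_of_not_mem (show ω ∉ D from fun h => hωE h.2),
          ind_of_not_mem (fun h => hωE ((hloc ω hP).1 h)), mul_zero]
    · rw [if_neg hP, zero_mul, ind_of_not_mem (show ω ∉ D from fun h => hP h.1), mul_zero]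
  have hpt' : ∀ ω : BondConfig V,
      (∫ η, F (openCluster (η \ {e | ∃ v ∈ e, v ∈ openCluster ω x}) z) ∂μ) * ind D ω =
      Φ (openEdgeCluster ω x) *
        ((∑ η, weight w' η * f (η \ {e | ∃ v ∈ e, v = x ∨ ∃ e' ∈ openEdgeCluster ω x, v ∈ e'})) *
          g (ω \ {e | ∃ v ∈ e, v = x ∨ ∃ e' ∈ openEdgeCluster ω x, v ∈ e'})) := by
    intro ω
    rw [hΦC ω, barV_openCluster_eq ω x, integral_prodBernoulli_eq_sum]
    by_cases hP : P (openCluster ω x)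
    · rw [if_pos hP, one_mul, hg]
      by_cases hωE : ω ∈ E
      · rw [ind_of_mem (show ω ∈ D from ⟨hP, hωE⟩), ind_of_mem ((hloc ω hP).2 hωE)]
      · rw [ind_of_not_mem (show ω ∉ D from fun h => hωE h.2),
          ind_of_not_mem (fun h => hωE ((hloc ω hP).1 h)), mul_zero]
    · rw [if_neg hP, zero_mul, ind_of_not_mem (show ω ∉ D from fun h => hP h.1), mul_zero]
  rw [setIntegral_eq_sum w D, setIntegral_eq_sum w D]
  have key := offCluster_harris_le w x Φ hΦ0 f g hfm (fun ξ => hF0 _) hga hg1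
  calc ∑ ω, weight w' ω * (F (openCluster ω z) * ind D ω)
      = ∑ ω, weight w' ω * (Φ (openEdgeCluster ω x) *
          (f (ω \ {e | ∃ v ∈ e, v = x ∨ ∃ e' ∈ openEdgeCluster ω x, v ∈ e'}) *
            g (ω \ {e | ∃ v ∈ e, v = x ∨ ∃ e' ∈ openEdgeCluster ω x, v ∈ e'}))) :=
        Finset.sum_congr rfl fun ω _ => by rw [hpt ω]
    _ ≤ _ := key
    _ = ∑ ω, weight w' ω * ((∫ η, F (openCluster (η \ {e | ∃ v ∈ e, v ∈ openCluster ω x}) z) ∂μ) * ind D ω) :=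
        Finset.sum_congr rfl fun ω _ => by rw [hpt' ω]

/-- **Conditioning a function of another cluster on the cluster of `x` (tower property).**  With the notation of
`setIntegral_offEvent_le` and no off-cluster event: `∫_{P(C_x)} F(C_z) = ∫_{P(C_x)} k_F(C_x)` (display (10)).
[cite: VandenbergHaggstromKahn2005, §1 pp. 7–8, display (10)] -/
theorem setIntegral_cluster_tower (w : Sym2 V → unitInterval) (x z : V) (F : Set V → ℝ) (P : Set V → Prop)
    (hPz : ∀ ω : BondConfig V, P (openCluster ω x) → ¬ (openGraph ω).Reachable x z) :
    ∫ ω in {ω : BondConfig V | P (openCluster ω x)}, F (openCluster ω z) ∂(prodBernoulli w) =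
      ∫ ω in {ω : BondConfig V | P (openCluster ω x)},
        (∫ η, F (openCluster (η \ {e | ∃ v ∈ e, v ∈ openCluster ω x}) z) ∂(prodBernoulli w)) ∂(prodBernoulli w) := by
  classical
  set μ := prodBernoulli w with hμ
  set w' : Sym2 V → ℝ := fun e => (w e : ℝ) with hw'
  have hm : ∑ ω, weight w' ω = 1 := by
    have h1 := integral_prodBernoulli_eq_sum w fun _ => (1 : ℝ)
    simp only [integral_const, probReal_univ, smul_eq_mul, mul_one] at h1
    exact h1.symm
  set D : Set (BondConfig V) := {ω : BondConfig V | P (openCluster ω x)} with hD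
  set Φ : Set (Sym2 V) → ℝ := fun C => if P {a | a = x ∨ ∃ e ∈ C, a ∈ e} then 1 else 0 with hΦ
  set f : BondConfig V → ℝ := fun ξ => F (openCluster ξ z) with hf
  have hΦC : ∀ ω : BondConfig V, Φ (openEdgeCluster ω x) = ind D ω := by
    intro ω
    simp only [hΦ, ← openCluster_eq_setOf_openEdgeCluster]
    by_cases hP : P (openCluster ω x)
    · rw [if_pos hP, ind_of_mem (show ω ∈ D from hP)]
    · rw [if_neg hP, ind_of_not_mem (show ω ∉ D from hP)]
  have hpt : ∀ ω : BondConfig V, F (openCluster ω z) * ind D ω =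
      Φ (openEdgeCluster ω x) * f (ω \ {e | ∃ v ∈ e, v = x ∨ ∃ e' ∈ openEdgeCluster ω x, v ∈ e'}) := by
    intro ω
    rw [hΦC ω, hf]
    by_cases hP : P (openCluster ω x)
    · simp only
      rw [openCluster_sdiff_bar_eq (hPz ω hP), mul_comm]
    · rw [ind_of_not_mem (show ω ∉ D from hP), mul_zero, zero_mul]
  have e1 := sum_cond_cluster_sdiff w' hm x (fun C ξ => Φ C * f ξ)
  rw [setIntegral_eq_sum w D, setIntegral_eq_sum w D]
  calc ∑ ω, weight w' ω * (F (openCluster ω z) * ind D ω)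
      = ∑ ω, weight w' ω * (Φ (openEdgeCluster ω x) *
          f (ω \ {e | ∃ v ∈ e, v = x ∨ ∃ e' ∈ openEdgeCluster ω x, v ∈ e'})) :=
        Finset.sum_congr rfl fun ω _ => by rw [hpt ω]
    _ = _ := e1
    _ = ∑ ω, weight w' ω * ((∫ η, F (openCluster (η \ {e | ∃ v ∈ e, v ∈ openCluster ω x}) z) ∂μ) * ind D ω) := by
        refine Finset.sum_congr rfl fun ω _ => ?_
        congr 1
        rw [← hΦC ω, barV_openCluster_eq ω x, integral_prodBernoulli_eq_sum, Finset.sum_mul]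
        exact Finset.sum_congr rfl fun η _ => by simp only [hw', hf]; ring


end Q7Psi

end

end Summit.CriticalPhenomena.PercolationContinuityZ3.Theorems
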